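import Mathlib
import Literature.Dynamics.ConleyIndex.PolyfacialBlock
import HarnessLib

/-!
# Stub `stub_exitClosed_of_transversal` of line `Sketch` — crux `WazewskiBlock.UniformGalerkinTrap`
# (stmt-AnomalousDissipation-10352)

Sorry-free discharge of the registered stub `stub_exitClosed_of_transversal` of the lead's skeleton
(`Cruxes/UniformGalerkinTrap/Lines/Sketch.lean`): the **exit set of a transversal polyfacial set
relative to a closed forward-invariant set** — pure topological dynamics over the tree vocabulary
`Literature.Dynamics.ConleyIndex.{Semiflow, PolyfacialSet}` (`IsSemiflow`, `faceSet`,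
`immediateExitSet`).

**Statement.** Let `φ` be a continuous semiflow on `X`, `h i` (`i : ι`, finitely many) continuous
faces with continuous derivatives `d i` along the flow (`s ↦ h i (φ s x)` has derivative
`d i (φ t x)` at every `t > 0`), `M` a closed forward-invariant set, and assume transversality of the
active faces ON `faceSet h ∩ M` only: `x ∈ faceSet h ∩ M`, `h i x = 0 ⇒ d i x ≠ 0`.  Then Conley's
immediate exit set of `B = faceSet h ∩ M = {x ∈ M | ∀ i, 0 ≤ h i x}` is the explicit first-order set
`B⁻ = {x ∈ B | ∃ i, h i x = 0 ∧ d i x < 0}`, and it is closed.  This is the tree's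
`IsRegularPolyfacial.immediateExitSet_eq` / `isClosed_immediateExitSet` with the invariant
constraint set `M` added: since `M` is forward invariant, a point of `B` leaves `B` iff it leaves
`faceSet h`, and every orbit used starts in `M` and stays in `M`.

**Proof.** The tree's local lemmas re-run with the structure `IsRegularPolyfacial` replaced by its
four non-transversality fields (they never use `deriv_ne_zero`), for ONE face `g` with derivative
`e` along the flow:
* `stub_exitClosed_aux_pos_of_deriv_pos`: `g x = 0`, `e x > 0` ⇒ `g (φ s x) > 0` for `s ∈ (0, ε]`
  (continuity of `e` along the orbit from the right at `0`, then the mean value theorem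
  `strictMonoOn_of_deriv_pos` on `[0, ε]`); its mirror image `…_neg_of_deriv_neg` (apply to `-g`,
  `-e`); and `…_pos_of_pos`: an inactive face stays positive on `[0, ε]` (continuity).
* `⊆`: if `x ∈ B⁻` had all active `d i x ≥ 0`, transversality on `B` gives `d i x > 0`, so for small
  `s > 0` every face is positive at `φ s x` (finitely many faces, `eventually_all` in `𝓝[>] 0`) and
  `φ s x ∈ M` by invariance: `φ s x ∈ B`, contradicting immediate exit.
* `⊇`: an active face with `d i x < 0` is negative at `φ s x` for all small `s > 0`, so
  `φ s x ∉ faceSet h ⊇ B`.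
* closedness: by transversality on `B`, `B⁻ = B ∩ ⋃ i, ({h i = 0} ∩ {d i ≤ 0})`, closed as `M` is
  closed, the faces and derivatives are continuous and `ι` is finite.

References: T. Ważewski, Ann. Soc. Polon. Math. 20 (1947) 279–313 (regular polyfacial sets);
P. Hartman, *Ordinary Differential Equations*, 2nd ed., SIAM 2002, Ch. X §3, Lemma 3.1, p. 280
(egress set of a `(u, v)`-subset); C. Conley, *Isolated Invariant Sets and the Morse Index*, CBMS 38
(1978), Ch. II (the sets `W⁰`, `W⁻`); J. K. Hale, L. T. Magalhães, W. M. Oliva, *Dynamics in Infinite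
Dimensions*, 2nd ed., Springer 2002, App. A, p. 244.
-/

-- `Summit.<Summit>.<Problem>` is the tree's mandated summit-side namespace (CONVENTIONS §2); deliberate duplicate.
set_option linter.dupNamespace false

namespace Summit.AnomalousDissipation.AnomalousDissipation.Theorems.UniformGalerkinTrap.Sketch

open Set Filter Topology
open Literature.Dynamics.ConleyIndex

/-! ## One face along one orbit, just after time `0` -/

/-- **An active face with positive derivative becomes positive.**  For a continuous semiflow `φ`,
a continuous face `g` whose derivative along the orbit of `x` at every time `t > 0` is `e (φ t x)`
with `e` continuous: if `g x = 0` and `e x > 0` then `g (φ s x) > 0` for all `s ∈ (0, ε]`, some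
`ε > 0` (right-continuity of `s ↦ e (φ s x)` at `0`, then the mean value theorem on `[0, ε]`).
The tree's `IsRegularPolyfacial.face_pos_of_deriv_pos` without the transversality field. [folklore] -/
theorem stub_exitClosed_aux_pos_of_deriv_pos {X : Type*} [TopologicalSpace X] {φ : ℝ → X → X}
    (hφ : IsSemiflow φ) {g e : X → ℝ} (hg : Continuous g) (he : Continuous e) {x : X}
    (hder : ∀ t : ℝ, 0 < t → HasDerivAt (fun s => g (φ s x)) (e (φ t x)) t)
    (h0 : g x = 0) (hpos : 0 < e x) : ∃ ε > 0, ∀ s ∈ Ioc 0 ε, 0 < g (φ s x) := by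
  have hc : ContinuousWithinAt (fun s => e (φ s x)) (Ici 0) 0 :=
    he.continuousAt.comp_continuousWithinAt (hφ.continuousWithinAt_orbit x le_rfl)
  have hpos' : 0 < e (φ 0 x) := by rwa [hφ.map_zero]
  have hev : ∀ᶠ s in 𝓝[Ici (0 : ℝ)] 0, 0 < e (φ s x) := hc (isOpen_Ioi.mem_nhds hpos')
  rw [nhdsWithin, eventually_inf_principal, Metric.eventually_nhds_iff] at hev
  obtain ⟨ε, hε, hball⟩ := hev
  have hmono : StrictMonoOn (fun s => g (φ s x)) (Icc 0 (ε / 2)) := by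
    refine strictMonoOn_of_deriv_pos (convex_Icc _ _) ?_ fun s hs => ?_
    · exact hg.comp_continuousOn ((hφ.continuousOn_orbit x).mono fun s hs => hs.1)
    · rw [interior_Icc] at hs
      rw [(hder s hs.1).deriv]
      refine hball ?_ hs.1.le
      rw [Real.dist_eq, sub_zero, abs_of_pos hs.1]
      linarith [hs.2]
  refine ⟨ε / 2, by positivity, fun s hs => ?_⟩
  have hlt := hmono (left_mem_Icc.2 (by positivity)) ⟨hs.1.le, hs.2⟩ hs.1
  simpa [hφ.map_zero, h0] using hlt

/-- **An active face with negative derivative becomes negative**: under the same hypotheses, if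
`g x = 0` and `e x < 0` then `g (φ s x) < 0` for all `s ∈ (0, ε]`, some `ε > 0` (the previous
lemma for `-g`, `-e`).  The tree's `IsRegularPolyfacial.face_neg_of_deriv_neg` without the
transversality field. [folklore] -/
theorem stub_exitClosed_aux_neg_of_deriv_neg {X : Type*} [TopologicalSpace X] {φ : ℝ → X → X}
    (hφ : IsSemiflow φ) {g e : X → ℝ} (hg : Continuous g) (he : Continuous e) {x : X}
    (hder : ∀ t : ℝ, 0 < t → HasDerivAt (fun s => g (φ s x)) (e (φ t x)) t)
    (h0 : g x = 0) (hneg : e x < 0) : ∃ ε > 0, ∀ s ∈ Ioc 0 ε, g (φ s x) < 0 := by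
  obtain ⟨ε, hε, hε'⟩ := stub_exitClosed_aux_pos_of_deriv_pos hφ (g := fun y => -g y)
    (e := fun y => -e y) hg.neg he.neg (x := x) (fun t ht => (hder t ht).neg) (by simp [h0])
    (by simpa using hneg)
  exact ⟨ε, hε, fun s hs => by simpa using hε' s hs⟩

/-- **An inactive face stays positive**: for a continuous semiflow `φ` and a continuous face `g`
with `g x > 0`, `g (φ s x) > 0` for all `s ∈ [0, ε]`, some `ε > 0` (right-continuity of the orbit
at `0`).  The tree's `IsRegularPolyfacial.face_pos_of_face_pos` without the structure. [folklore] -/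
theorem stub_exitClosed_aux_pos_of_pos {X : Type*} [TopologicalSpace X] {φ : ℝ → X → X}
    (hφ : IsSemiflow φ) {g : X → ℝ} (hg : Continuous g) {x : X} (hpos : 0 < g x) :
    ∃ ε > 0, ∀ s ∈ Icc 0 ε, 0 < g (φ s x) := by
  have hc : ContinuousWithinAt (fun s => g (φ s x)) (Ici 0) 0 :=
    hg.continuousAt.comp_continuousWithinAt (hφ.continuousWithinAt_orbit x le_rfl)
  have hpos' : 0 < g (φ 0 x) := by rwa [hφ.map_zero]
  have hev : ∀ᶠ s in 𝓝[Ici (0 : ℝ)] 0, 0 < g (φ s x) := hc (isOpen_Ioi.mem_nhds hpos')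
  rw [nhdsWithin, eventually_inf_principal, Metric.eventually_nhds_iff] at hev
  obtain ⟨ε, hε, hball⟩ := hev
  refine ⟨ε / 2, by positivity, fun s hs => hball ?_ hs.1⟩
  rw [Real.dist_eq, sub_zero, abs_of_nonneg hs.1]
  linarith [hs.2]

/-! ## The stub -/

/-- **Exit set of a transversal polyfacial set relative to a closed forward-invariant set**
(registered stub `stub_exitClosed_of_transversal` of line `Sketch`).  For a continuous semiflow
`φ`, finitely many continuous faces `h i` with continuous derivatives `d i` along the flow, a closed
forward-invariant `M`, and transversality of the active faces on `faceSet h ∩ M`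
(`h i x = 0 ⇒ d i x ≠ 0`): the immediate exit set of `faceSet h ∩ M` is
`{x ∈ faceSet h ∩ M | ∃ i, h i x = 0 ∧ d i x < 0}`, and it is closed.  The tree's
`IsRegularPolyfacial.immediateExitSet_eq` / `isClosed_immediateExitSet` (Hartman's Lemma 3.1,
closed-set form) re-run inside the invariant set `M`. [folklore] -/
theorem stub_exitClosed_of_transversal :
    ∀ {X : Type} [TopologicalSpace X] {ι : Type} [Finite ι] (φ : ℝ → X → X) (h d : ι → X → ℝ)
      (M : Set X), IsSemiflow φ → (∀ i, Continuous (h i)) → (∀ i, Continuous (d i)) →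
      (∀ i x t, 0 < t → HasDerivAt (fun s => h i (φ s x)) (d i (φ t x)) t) →
      IsClosed M → (∀ x ∈ M, ∀ t : ℝ, 0 ≤ t → φ t x ∈ M) →
      (∀ x ∈ faceSet h ∩ M, ∀ i, h i x = 0 → d i x ≠ 0) →
      immediateExitSet φ (faceSet h ∩ M) =
          {x | x ∈ faceSet h ∩ M ∧ ∃ i, h i x = 0 ∧ d i x < 0} ∧
        IsClosed (immediateExitSet φ (faceSet h ∩ M)) := by
  intro X _ ι _ φ h d M hφ hh hd hder hM hinv hne
  -- (1)+(2): the exit set is the explicit first-order set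
  have heq : immediateExitSet φ (faceSet h ∩ M) =
      {x | x ∈ faceSet h ∩ M ∧ ∃ i, h i x = 0 ∧ d i x < 0} := by
    ext x
    constructor
    · intro hx
      refine ⟨hx.1, ?_⟩
      by_contra hne'
      push Not at hne'
      -- every active face has positive derivative, by transversality on `faceSet h ∩ M`
      have hpos : ∀ i, h i x = 0 → 0 < d i x := fun i hi =>
        (hne x hx.1 i hi).symm.lt_of_le (hne' i hi)
      -- hence all faces are positive just after time `0`
      have hall : ∀ᶠ s in 𝓝[>] (0 : ℝ), ∀ i, 0 < h i (φ s x) := by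
        refine eventually_all.2 fun i => ?_
        rcases (hx.1.1 i).eq_or_lt with h0 | hlt
        · obtain ⟨ε, hε, hε'⟩ := stub_exitClosed_aux_pos_of_deriv_pos hφ (hh i) (hd i)
            (hder i x) h0.symm (hpos i h0.symm)
          exact mem_of_superset (Ioc_mem_nhdsGT hε) hε'
        · obtain ⟨ε, hε, hε'⟩ := stub_exitClosed_aux_pos_of_pos hφ (hh i) hlt
          exact mem_of_superset (Ioc_mem_nhdsGT hε) fun s hs => hε' s ⟨hs.1.le, hs.2⟩
      obtain ⟨u, hu, hsub⟩ := mem_nhdsGT_iff_exists_Ioc_subset.1 hall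
      obtain ⟨t, ht, hout⟩ := hx.2 u hu
      -- and the orbit stays in `M`: contradiction with immediate exit
      exact hout ⟨fun i => (hsub ⟨ht.1, ht.2.le⟩ i).le, hinv x hx.1.2 t ht.1.le⟩
    · rintro ⟨hxB, i, hi, hdi⟩
      obtain ⟨ε, hε, hout⟩ := stub_exitClosed_aux_neg_of_deriv_neg hφ (hh i) (hd i) (hder i x)
        hi hdi
      refine ⟨hxB, fun δ hδ => ⟨min (ε / 2) (δ / 2), ⟨by positivity, ?_⟩, fun hmem => ?_⟩⟩
      · exact (min_le_right _ _).trans_lt (by linarith)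
      · exact (not_le.2 (hout _ ⟨by positivity, (min_le_left _ _).trans (by linarith)⟩))
          (hmem.1 i)
  refine ⟨heq, ?_⟩
  -- (3): closedness, upgrading `d i ≤ 0` to `< 0` on `faceSet h ∩ M` by transversality
  have heq' : immediateExitSet φ (faceSet h ∩ M) =
      (faceSet h ∩ M) ∩ ⋃ i, ({x | h i x = 0} ∩ {x | d i x ≤ 0}) := by
    rw [heq]
    ext x
    simp only [mem_setOf_eq, mem_inter_iff, mem_iUnion]
    constructor
    · rintro ⟨hxB, i, hi, hdi⟩
      exact ⟨hxB, i, hi, hdi.le⟩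
    · rintro ⟨hxB, i, hi, hdi⟩
      exact ⟨hxB, i, hi, hdi.lt_of_ne (hne x hxB i hi)⟩
  rw [heq']
  exact ((isClosed_faceSet hh).inter hM).inter (isClosed_iUnion_of_finite fun i =>
    (isClosed_eq (hh i) continuous_const).inter (isClosed_le (hd i) continuous_const))

end Summit.AnomalousDissipation.AnomalousDissipation.Theorems.UniformGalerkinTrap.Sketch
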